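import Mathlib
import Summits.RiemannHypothesis.RiemannHypothesis.Theorems.WeilFarFloorLawRH
import Summits.RiemannHypothesis.RiemannHypothesis.Theorems.WeilFarFloorResidualZeroSumRH
import HarnessLib

/-!
# The floor law C-XIII is equivalent to the Riemann Hypothesis

Helper file (`--supports stmt-RiemannHypothesis-0098`, lead-track anchor: Weil-positivity window ladder, format-C far bound),
pure proofs.  Seat rh-explicit-weil-1 gen13 (memo `run/shared/lean/pub/rh-explicit/rh-explicit-weil-1/FORMAT-K3.md` §14.7); the
capstone of the floor-law chain (gen7 statement `FarFloorDiscrepancyLe`, gen9 `WeilFarFloorLawRH`, gen10 `WeilFarFloorCoshZeroSum`,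
gen12–13 C-XIII″).

  **`farFloorLaw_iff_riemannHypothesis : (∃ C, FarFloorDiscrepancyLe C 1) ↔ RiemannHypothesis`**

— STRUCTURE.md's conjecture C-XIII («`|λ_max(a) − (pntFloor a − 2γ_E)| ≤ C` for all `a ≥ 1`», the far-coercivity floor of the Weil window
ladder against the top eigenvalue of the PNT kernel lowered by the Mertens constant) IS the Riemann Hypothesis:
(→) `WeilFarFloorLawRH.riemannHypothesis_of_farFloorDiscrepancyLe` (only the upper clause is used: the cosh test + Landau's
oscillation theorem for `∫₁ˣψ(t)dt/t`); (←) `WeilFarFloorResidualZeroSumRH.exists_farFloorDiscrepancyLe_of_RH` (C-XIII″ `λ_max − R_c → 0` + the cosh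
test's explicit prime sum; under RH even `|ε(a)| ≤ β + o(1)`, `β = 2 + γ − log 4π`, and `ε(a) + Z(a) → 0`).  Also the «eventually»
form `riemannHypothesis_iff_eventually_abs_farFloorDiscrepancy_le`.  Standard axioms only; an EQUIVALENCE — nothing here bears on the
truth of RH.
-/

set_option linter.dupNamespace false
set_option autoImplicit false

noncomputable section

open MeasureTheory Set Filter Topology
open scoped Real

namespace Summit.RiemannHypothesis.RiemannHypothesis.Theorems.WeilFormatC

namespace FloorCoshSplit

open Literature.NumberTheory.LFunctions FloorCosh FloorLaw

/-- **C-XIII ⟺ RH.** -/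
theorem farFloorLaw_iff_riemannHypothesis : (∃ C, FarFloorDiscrepancyLe C 1) ↔ RiemannHypothesis :=
  ⟨fun ⟨_, h⟩ ↦ riemannHypothesis_of_farFloorDiscrepancyLe h, fun hRH ↦ exists_farFloorDiscrepancyLe_of_RH hRH⟩

/-- **RH ⟺ the floor discrepancy is eventually bounded** (threshold-free form). -/
theorem riemannHypothesis_iff_eventually_abs_farFloorDiscrepancy_le :
    RiemannHypothesis ↔
      ∃ C : ℝ, ∀ᶠ a : ℝ in atTop, |farCoercivityFloor a - (pntFloor a - 2 * Real.eulerMascheroniConstant)| ≤ C := by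
  constructor
  · intro hRH
    exact ⟨nicolasBeta + 1, eventually_abs_farFloorDiscrepancy_le_beta_of_RH hRH one_pos⟩
  · rintro ⟨C, hC⟩
    obtain ⟨C', hC'⟩ := exists_farFloorDiscrepancyLe_of_eventually hC
    exact riemannHypothesis_of_farFloorDiscrepancyLe hC'

/-- **RH ⟺ the UPPER clause of the floor law** (`∃ C a₀, ∀ a ≥ a₀, λ_max(a) ≤ pntFloor a − 2γ_E + C`): the lower clause is automatic. -/
theorem riemannHypothesis_iff_farFloor_upper :
    RiemannHypothesis ↔
      ∃ C a₀ : ℝ, ∀ a : ℝ, a₀ ≤ a → farCoercivityFloor a ≤ pntFloor a - 2 * Real.eulerMascheroniConstant + C := by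
  constructor
  · intro hRH
    obtain ⟨C, hC⟩ := exists_farFloorDiscrepancyLe_of_RH hRH
    exact ⟨C, 1, fun a ha ↦ by have := (abs_le.1 (hC a ha)).2; linarith⟩
  · rintro ⟨C, a₀, h⟩
    exact riemannHypothesis_of_farFloor_le h

end FloorCoshSplit

end Summit.RiemannHypothesis.RiemannHypothesis.Theorems.WeilFormatC
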